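import Summits.QuantumFields.YangMills.Theorems.BalabanUVNodesN15KingModelTiltedPauli
import Summits.QuantumFields.YangMills.Theorems.BalabanUVNodesN15KingModelPauliLinksScaling
import HarnessLib

/-!
# BalabanUVNodes ∕ N15 — THE KING-MODEL RUNG (PART Ϸ-m): THE TILTED PAIR IN KING's UNITS — `c = η⁻²`, `a = αη`, `b = βη`, fixed tilt `φ` (`cos φ ≥ 0`): the mass floor
# `pauliScaled α β η·(1 − cos φ) → min(α²,β²)·(1 − cos φ)` (η-uniform `≥ ⅔min(α²,β²)(1 − cos φ)`), the curvature `pauliCurvScaled α β η·|sin φ| → 2αβ|sin φ|`: in the continuum limit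
# mass∕curvature `= tan(φ∕2)·min∕(2max)` — the torus statements in physical units and the tilted package
# (Track A, DAG node N15 = NE2 «η-rates»; FAN-OUT v1.1 §N15 s3 «KING-MODEL RUNG … + what the curved case adds»; count-neutral)

HONEST FRAMING.  Count-neutral (cell `pub-ymgap`, seat `pub-ymgap-dag-n15-e` g48; `--supports stmt-QuantumFields-27247 --as helper` = K3ᴬ, KEY MAP v3).  Elementary rescaling of PART Ϸ-l by
PART Ϸ-f's letters; one finite torus per spacing; NOT Bałaban's `G_k(U)`; NOT a node discharge (N15 of record untouched); nothing continuum-YM ∕ ℝ⁴ ∕ OS ∕ Clay.  (For the isotropic tilted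
pair the continuum symbol `Σ_μ(q_μ + A_μ)²`, `A₀ = ασ₁`, `A₁ = ασ_φ`, has bottom exactly `α²(1 − cos φ)` — the floor below is asymptotically of the right form; not typed.)

THE RESULTS (`α, β ≥ 0`, `η > 0`, `cos φ ≥ 0`, `ν₀ ≠ ν₁`):
* ★★★ **`re_quadForm_covLapF_tiltedPauliLink_ge_physical`** (`(m² + pauliScaled α β η·(1 − cos φ))·Σ‖v_x‖² ≤ Re⟨v,(−η⁻²Δ_W+m²)v⟩` on every torus), ★★ `eigenvalues_covLapF_tiltedPauliLink_ge_physical_uniform`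
  (`≥ m² + ⅔min(α²,β²)(1 − cos φ)` for `αη, βη ≤ 1`), ★★★ **`tendsto_tiltedScaled`** (`pauliScaled α β η·(1 − cos φ) → min(α²,β²)(1 − cos φ)`), ★★ **`tendsto_tiltedCurvScaled`**
  (`pauliCurvScaled α β η·|sin φ| → 2αβ|sin φ|`), ★ `tiltedCurv_eq` (the lattice curvature of Ϸ-l IS `η²·pauliCurvScaled·|sin φ|∕…` bookkeeping: `2|sin a sin b sin φ| = 2|sin a sin b|·|sin φ|`),
  ★★★ **`king_tilted_package`** (Ϸ-l∕Ϸ-m by name: lattice gap, massless posDef + `‖G‖`, constant curvature, the two continuum limits).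
PRIOR TREE ART (by name): Ϸ-l (`tiltedPauliLink`, `re_quadForm_covLapF_tiltedPauliLink_ge`, `eigenvalues_covLapF_tiltedPauliLink_ge`, `posDef_covLapF_tiltedPauliLink_massless`,
`l2_opNorm_covLapF_tiltedPauliLink_massless_inv_le`, `norm_kingPlaq_tilted_sub_self`), Ϸ-f (`pauliScaled`, `pauliScaled_ge_uniform`, `tendsto_pauliScaled`, `pauliCurvScaled`, `tendsto_pauliCurvScaled`).
Dedup (rg at filing): basename 0 files; needles `tendsto_tiltedScaled|tendsto_tiltedCurvScaled|king_tilted_package|_tiltedPauliLink_ge_physical` 0 tree files.  Locators: [King1986] (4.4) p.670,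
Lemma 4.5 (4.38) p.674, (2.12) p.653; [Balaban1985BackgroundPropagators] (3.23) p.394, (3.46) p.398.  0 `sorry`, 0 `def`.
-/

noncomputable section

open scoped BigOperators ComplexConjugate ComplexOrder InnerProductSpace Topology Matrix.Norms.L2Operator
open Finset Matrix WithLp Filter

namespace Summit.QuantumFields.YangMills.BalabanUVNodes.N15KingModelRung.ConstantCurvature

open Literature.MathematicalPhysics.QuantumFieldTheory.Balaban1983to89.B5Prop11Plancherel (Tor unitVec)
open Summit.QuantumFields.YangMills.BalabanUVNodes.N15KingModelRung.Covariant (covLapF fib isHermitian_covLapF)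
open Summit.QuantumFields.YangMills.BalabanUVNodes.N15KingModelRung.Cover (kingPlaq)

variable {d : ℕ} (K : Fin (d + 1) → ℕ) [hK : ∀ μ, NeZero (K μ)]

/-- ★★★ **THE TILTED GAP IN PHYSICAL UNITS** (`c = η⁻²`, `a = αη`, `b = βη`, `cos φ ≥ 0`): `(m² + pauliScaled α β η·(1 − cos φ))·Σ‖v_x‖² ≤ Re⟨v,(−η⁻²Δ_W+m²)v⟩` on every torus.
[cite: King1986, (4.4) p.670, (4.38) p.674; Balaban1985BackgroundPropagators, (3.23) p.394] -/
theorem re_quadForm_covLapF_tiltedPauliLink_ge_physical {η : ℝ} (hη : 0 < η) (m2 α β : ℝ) {φ : ℝ} (hφ : 0 ≤ Real.cos φ) {ν₀ ν₁ : Fin (d + 1)} (hν : ν₀ ≠ ν₁)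
    (v : Tor K × Fin 2 → ℂ) :
    (m2 + pauliScaled α β η * (1 - Real.cos φ)) * ∑ x, ‖fib K v x‖ ^ 2
      ≤ RCLike.re (star v ⬝ᵥ (covLapF K (η⁻¹ ^ 2) m2 (kingConstLink K (tiltedPauliLink (α * η) (β * η) φ ν₀ ν₁)) *ᵥ v)) := by
  have h := re_quadForm_covLapF_tiltedPauliLink_ge K (by positivity : (0 : ℝ) ≤ η⁻¹ ^ 2) m2 (α * η) (β * η) hφ hν v
  have heq : η⁻¹ ^ 2 * (min (Real.sin (α * η) ^ 2) (Real.sin (β * η) ^ 2) * (1 - Real.cos φ)) = pauliScaled α β η * (1 - Real.cos φ) := by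
    unfold pauliScaled; ring
  rwa [heq] at h

/-- ★★ **η-UNIFORM TILTED FLOOR**: every eigenvalue of `−η⁻²Δ_W + m²` is `≥ m² + ⅔·min(α²,β²)·(1 − cos φ)` for every spacing with `αη, βη ≤ 1` (`α, β ≥ 0`, `cos φ ≥ 0`).
[cite: King1986, (4.4) p.670, (4.38) p.674; Balaban1985BackgroundPropagators, (3.23) p.394] -/
theorem eigenvalues_covLapF_tiltedPauliLink_ge_physical_uniform {η α β : ℝ} (hη : 0 < η) (hα : 0 ≤ α) (hβ : 0 ≤ β) (ha : α * η ≤ 1) (hb : β * η ≤ 1) (m2 : ℝ)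
    {φ : ℝ} (hφ : 0 ≤ Real.cos φ) {ν₀ ν₁ : Fin (d + 1)} (hν : ν₀ ≠ ν₁) (i : Tor K × Fin 2) :
    m2 + 2 / 3 * min (α ^ 2) (β ^ 2) * (1 - Real.cos φ)
      ≤ (isHermitian_covLapF K (η⁻¹ ^ 2) m2 (kingConstLink K (tiltedPauliLink (α * η) (β * η) φ ν₀ ν₁))).eigenvalues i := by
  have h := eigenvalues_covLapF_tiltedPauliLink_ge K (by positivity : (0 : ℝ) ≤ η⁻¹ ^ 2) m2 (α * η) (β * η) hφ hν i
  have hu := pauliScaled_ge_uniform hα hβ hη ha hb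
  unfold pauliScaled at hu
  have h1c : 0 ≤ 1 - Real.cos φ := by linarith [Real.cos_le_one φ]
  have : 2 / 3 * min (α ^ 2) (β ^ 2) * (1 - Real.cos φ) ≤ η⁻¹ ^ 2 * (min (Real.sin (α * η) ^ 2) (Real.sin (β * η) ^ 2) * (1 - Real.cos φ)) := by
    nlinarith [mul_le_mul_of_nonneg_right hu h1c]
  linarith

/-- ★★★ **THE CONTINUUM LIMIT OF THE TILTED MASS FLOOR**: `pauliScaled α β η·(1 − cos φ) → min(α²,β²)·(1 − cos φ)` as `η → 0⁺` (`α, β ≥ 0`). [cite: King1986, (4.38) p.674, (4.4) p.670] -/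
theorem tendsto_tiltedScaled {α β : ℝ} (hα : 0 ≤ α) (hβ : 0 ≤ β) (φ : ℝ) :
    Tendsto (fun η : ℝ => pauliScaled α β η * (1 - Real.cos φ)) (𝓝[>] 0) (𝓝 (min (α ^ 2) (β ^ 2) * (1 - Real.cos φ))) :=
  (tendsto_pauliScaled hα hβ).mul_const _

omit hK in
/-- THE LATTICE CURVATURE OF THE TILTED PAIR factorises: `2|sin a·sin b·sin φ| = (2|sin a·sin b|)·|sin φ|`. [folklore] -/
theorem tiltedCurv_eq (a b φ : ℝ) : 2 * |Real.sin a * Real.sin b * Real.sin φ| = 2 * |Real.sin a * Real.sin b| * |Real.sin φ| := by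
  rw [abs_mul]; ring

/-- ★★ **THE CONTINUUM LIMIT OF THE TILTED CURVATURE**: `η⁻²·2|sin αη·sin βη·sin φ| = pauliCurvScaled α β η·|sin φ| → 2αβ·|sin φ|` as `η → 0⁺` (`α, β ≥ 0`).
[cite: King1986, (2.12) p.653, (4.38) p.674] -/
theorem tendsto_tiltedCurvScaled {α β : ℝ} (hα : 0 ≤ α) (hβ : 0 ≤ β) (φ : ℝ) :
    Tendsto (fun η : ℝ => η⁻¹ ^ 2 * (2 * |Real.sin (α * η) * Real.sin (β * η) * Real.sin φ|)) (𝓝[>] 0) (𝓝 (2 * α * β * |Real.sin φ|)) := by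
  have h := (tendsto_pauliCurvScaled hα hβ).mul_const |Real.sin φ|
  refine h.congr' (Eventually.of_forall fun η => ?_)
  show pauliCurvScaled α β η * |Real.sin φ| = η⁻¹ ^ 2 * (2 * |Real.sin (α * η) * Real.sin (β * η) * Real.sin φ|)
  rw [tiltedCurv_eq, pauliCurvScaled]; ring

/-- ★★★ **THE TILTED PACKAGE** (`c > 0`, `sin a sin b ≠ 0`, `0 ≤ cos φ < 1`, `ν₀ ≠ ν₁`; and `α, β ≥ 0` for the limits): (1) the lattice gap `m² + c·min(sin²a,sin²b)(1 − cos φ)`; (2) massless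
`−cΔ_W ≻ 0` with `‖(−cΔ_W)⁻¹‖ ≤ (c·min·(1 − cos φ))⁻¹`; (3) constant curvature `‖Pu − u‖ = 2|sin a sin b sin φ|‖u‖`; (4) in King's units the floor `→ min(α²,β²)(1 − cos φ)` and the
curvature `→ 2αβ|sin φ|` — mass∕curvature `→ tan(φ∕2)·min∕(2max)`: the abelian limit `φ → 0` is massless to second order. [cite: King1986, (2.12) p.653, (4.4) p.670, (4.38) p.674; Balaban1985BackgroundPropagators, (3.23) p.394, (3.46) p.398] -/
theorem king_tilted_package {c : ℝ} (hc : 0 < c) (m2 : ℝ) {a b φ : ℝ} (ha : Real.sin a ≠ 0) (hb : Real.sin b ≠ 0) (hφ : 0 ≤ Real.cos φ) (hφ1 : Real.cos φ < 1)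
    {ν₀ ν₁ : Fin (d + 1)} (hν : ν₀ ≠ ν₁) {α β : ℝ} (hα : 0 ≤ α) (hβ : 0 ≤ β) :
    (∀ v : Tor K × Fin 2 → ℂ, (m2 + c * (min (Real.sin a ^ 2) (Real.sin b ^ 2) * (1 - Real.cos φ))) * ∑ x, ‖fib K v x‖ ^ 2
        ≤ RCLike.re (star v ⬝ᵥ (covLapF K c m2 (kingConstLink K (tiltedPauliLink a b φ ν₀ ν₁)) *ᵥ v)))
    ∧ ((covLapF K c 0 (kingConstLink K (tiltedPauliLink a b φ ν₀ ν₁))).PosDef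
        ∧ ‖(covLapF K c 0 (kingConstLink K (tiltedPauliLink a b φ ν₀ ν₁)))⁻¹‖ ≤ (c * (min (Real.sin a ^ 2) (Real.sin b ^ 2) * (1 - Real.cos φ)))⁻¹)
    ∧ (∀ (x : Tor K) (u : EuclideanSpace ℂ (Fin 2)),
        ‖Matrix.toEuclideanLin (kingPlaq K (kingConstLink K (tiltedPauliLink a b φ ν₀ ν₁)) x ν₀ ν₁) u - u‖ = 2 * |Real.sin a * Real.sin b * Real.sin φ| * ‖u‖)
    ∧ (Tendsto (fun η : ℝ => pauliScaled α β η * (1 - Real.cos φ)) (𝓝[>] 0) (𝓝 (min (α ^ 2) (β ^ 2) * (1 - Real.cos φ)))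
        ∧ Tendsto (fun η : ℝ => η⁻¹ ^ 2 * (2 * |Real.sin (α * η) * Real.sin (β * η) * Real.sin φ|)) (𝓝[>] 0) (𝓝 (2 * α * β * |Real.sin φ|))) :=
  ⟨fun v => re_quadForm_covLapF_tiltedPauliLink_ge K hc.le m2 a b hφ hν v,
   ⟨posDef_covLapF_tiltedPauliLink_massless K hc ha hb hφ hφ1 hν, l2_opNorm_covLapF_tiltedPauliLink_massless_inv_le K hc ha hb hφ hφ1 hν⟩,
   fun x u => norm_kingPlaq_tilted_sub_self K a b φ hν x u,
   ⟨tendsto_tiltedScaled hα hβ φ, tendsto_tiltedCurvScaled hα hβ φ⟩⟩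

end Summit.QuantumFields.YangMills.BalabanUVNodes.N15KingModelRung.ConstantCurvature

end
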